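import Summits.BirchSwinnertonDyer.Rank1Residual.GaloisImage.MordellWeilIndexCertificatesThree
import HarnessLib

/-!
# Kernel instance of the three-point index certificate `27 ≤ [E′(ℚ):3E′(ℚ)]` (team n1011, row
# T-DIV3L, FILE D12)

HONEST FRAMING (cell `b2b-bsdres`, run/shared/lean/b2b/bsd-rank1-residual/, verbatim in every
file): the goal of the cell is to DELETE the COMBINATION-SHAPED residual classes of the
Birch–Swinnerton-Dyer formula for ALL analytic-rank `≤ 1` elliptic curves over `ℚ` — "full BSD
formula for every rank `≤ 1` curve in class `C`" assembled STRICTLY from published theorems — so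
that the rank-`≤ 1` remainder becomes exactly the CONSTRUCTION-SHAPED classes, which are TYPED
(missing-input `Prop`s), NOT attempted. This is not "finishing BSD". Team n1011 (N10/N11): research
route; this file is a per-curve KERNEL INSTANCE of FILE D11's certificate (a TOOL); nothing is
booked by it; no mark / label moved; X4 stays CONSTRUCTION-SHAPED. THEOREMS only; no definition,
no named fact, no `sorry`.

Census (EVIDENCE, `HOME/b2b-bsdres-n1011-p17/gen9/census/idx27_certs.json`, script
`idx27_cert.py`): all 305 rank-3 partners of r1's pair tables carry the thirteen certificates
(`ℓ ≤ 101`, `k ≤ 4`) with the five `x`-inequalities of the chord lemmas satisfied.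
-/

set_option autoImplicit false

open WeierstrassCurve

namespace Summit.BirchSwinnertonDyer.Rank1Residual.GaloisImage.DivisionDecider

/-- **Instance `134568g1`** (`[0, 0, 0, -327, 2410]`, Cremona rank 3, r1 verdict PASS-rank3):
generators `P₁ = (9, 14)`, `P₂ = (23, 84)`, `P₃ = (-19, 42)`; the ten compound points and the thirteen
NO-primes `[11, 3, 3, 3, 3, 3, 3, 3, 3, 3, 3, 3, 17]` (depths `[1,1,1,1,1,1,1,2,1,2,1,1,1]`) from the
census `gen9/census/idx27_certs.json`; chord identities and certificates by `decide +kernel` (after `clear d`: the displayed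
instance must not shadow `instDecidableEqRat` inside the numeral checks); the thirteen `Nonsingular`
facts displayed (decidable, left to the record). [folklore] -/
theorem twentyseven_le_index_134568g1 (W' : WeierstrassCurve ℚ) [W'.IsElliptic]
    (hW' : W' = ⟨0, 0, 0, -327, 2410⟩)
    (h₁ : W'.toAffine.Nonsingular 9 14)
    (h₂ : W'.toAffine.Nonsingular 23 84)
    (h₃ : W'.toAffine.Nonsingular (-19) 42)
    (n₁ : W'.toAffine.Nonsingular (-7) 66)
    (n₂ : W'.toAffine.Nonsingular 17 42)
    (n₃ : W'.toAffine.Nonsingular 11 (-12))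
    (n₄ : W'.toAffine.Nonsingular 14 (-24))
    (n₅ : W'.toAffine.Nonsingular (-3) (-58))
    (n₆ : W'.toAffine.Nonsingular 5 (-30))
    (n₇ : W'.toAffine.Nonsingular 30 (-140))
    (n₈ : W'.toAffine.Nonsingular 107 (-1092))
    (n₉ : W'.toAffine.Nonsingular 2 (-42))
    (n₁₀ : W'.toAffine.Nonsingular (67 / 9) (-532 / 27)) (d : DecidableEq ℚ) :
    27 ≤ (letI : DecidableEq ℚ := d
      (zsmulAddGroupHom ((3 : ℕ) : ℤ) : W'.toAffine.Point →+ W'.toAffine.Point).range.index) :=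
  twentyseven_le_index_range_zsmul_three_of_checks 0 0 0 (-327) 2410 W' hW' h₁ h₂ h₃ n₁ n₂ n₃ n₄
    n₅ n₆ n₇ n₈ n₉ n₁₀
    (by norm_num) (by norm_num) (by norm_num) (by norm_num) (by norm_num)
    (by clear d; subst hW'; decide +kernel) (by clear d; subst hW'; decide +kernel)
    (by clear d; subst hW'; decide +kernel)
    (by clear d; subst hW'; decide +kernel) (by clear d; subst hW'; decide +kernel)
    (by clear d; subst hW'; decide +kernel)
    (by clear d; subst hW'; decide +kernel) (by clear d; subst hW'; decide +kernel)
    (by clear d; subst hW'; decide +kernel)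
    (by clear d; subst hW'; decide +kernel) (by clear d; subst hW'; decide +kernel)
    (by clear d; subst hW'; decide +kernel)
    (by clear d; subst hW'; decide +kernel) (by clear d; subst hW'; decide +kernel)
    (by clear d; subst hW'; decide +kernel)
    (by clear d; subst hW'; decide +kernel) (by clear d; subst hW'; decide +kernel)
    (by clear d; subst hW'; decide +kernel)
    (by clear d; subst hW'; decide +kernel) (by clear d; subst hW'; decide +kernel)
    (ℓ₁ := 11) (ℓ₂ := 3) (ℓ₃ := 3) (ℓ₄ := 3) (ℓ₅ := 3) (ℓ₆ := 3) (ℓ₇ := 3) (ℓ₈ := 3) (ℓ₉ := 3)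
    (ℓ₁₀ := 3) (ℓ₁₁ := 3) (ℓ₁₂ := 3) (ℓ₁₃ := 17)
    (hℓ₁ := ⟨by norm_num⟩) (hℓ₂ := ⟨Nat.prime_three⟩) (hℓ₃ := ⟨Nat.prime_three⟩)
    (hℓ₄ := ⟨Nat.prime_three⟩) (hℓ₅ := ⟨Nat.prime_three⟩) (hℓ₆ := ⟨Nat.prime_three⟩)
    (hℓ₇ := ⟨Nat.prime_three⟩) (hℓ₈ := ⟨Nat.prime_three⟩) (hℓ₉ := ⟨Nat.prime_three⟩)
    (hℓ₁₀ := ⟨Nat.prime_three⟩) (hℓ₁₁ := ⟨Nat.prime_three⟩) (hℓ₁₂ := ⟨Nat.prime_three⟩)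
    (hℓ₁₃ := ⟨by norm_num⟩)
    (k₁ := 1) (k₂ := 1) (k₃ := 1) (k₄ := 1) (k₅ := 1) (k₆ := 1) (k₇ := 1) (k₈ := 2) (k₉ := 1)
    (k₁₀ := 2) (k₁₁ := 1) (k₁₂ := 1) (k₁₃ := 1)
    (by decide +kernel) (by decide +kernel) (by decide +kernel) (by decide +kernel)
    (by decide +kernel) (by decide +kernel) (by decide +kernel) (by decide +kernel)
    (by decide +kernel) (by decide +kernel) (by decide +kernel) (by decide +kernel)
    (by decide +kernel) d

end Summit.BirchSwinnertonDyer.Rank1Residual.GaloisImage.DivisionDecider
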